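import Literature.NumberTheory.EllipticCurves.KummerImageIsotropy
import HarnessLib

/-!
# A biadditive Galois-equivariant `μ_N`-valued pairing on an ARBITRARY discrete Galois module, as a continuous pairing of `TopRep`s —
# the coefficient-generic form of the tree's `weilPairingValue` / `weilPairingHom` / `weilContPairing` (there: `M = E[N]`)

Topic `NumberTheory/EllipticCurves`, namespace `Literature.NumberTheory.EllipticCurves`. Lead prover of route `ResidualThetaTransportAtTwo` (cell
`bsd-wall`, seat `bsd-wall-rtt-p2` g16), item D2(a) of `Summits/…/Cruxes/ResidualThetaCountLowerPureAtTwo/PIN-SPEC-S2-g16.md`: the layer Tate pairing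
for the `ρ`-coefficient module `M = A_ρ[N]` (`GreenbergSelmer.cofreeTorsionGaloisModule`) is a cup product for a pairing `e : M × M → μ_N`
(self-duality of `ρ`); `CyclotomicLayerTatePairing.lean` and `KummerImageIsotropy.lean` build that cup product for `E[N]` ONLY. This file repeats
`KummerImageIsotropy.lean` ll. 100–180 VERBATIM with `geomTorsion W N`/`W.torsionGaloisModule N` replaced by `(M, ρM : DiscreteGaloisModule F M)`
and `σ • S` by `ρM σ S`; nothing else. DEFINITIONS WITH BODIES + unfolding lemmas; no named fact, no instance, no notation; nothing about BSD.

* `pairingValueOfFun e hμ S T : MuCarrier F N`, `coe_pairingValueOfFun`; `pairingHomOfFun e hμ hadd₁ hadd₂ : M →+ M →+ MuCarrier F N`,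
  `coe_pairingHomOfFun`; **`contPairingOfFun ρM e … hgal : ContPairing ρM.toTopRep ρM.toTopRep (mu F N).toTopRep`** (via the tree's
  `DiscreteGaloisModule.pairing`), `contPairingOfFun_toLin_apply`; the local version at a place of a number field
  **`contPairingOfFunLocal … v`** (`toLocal v`, twin of `weilContPairingLocal`).

References: J. S. Milne, *Arithmetic Duality Theorems* (2006), I §0 (pairings), I §2 Cor. 2.3; J. H. Silverman, *AEC* III §8 (the case `E[N]`).
-/

noncomputable section

open scoped Classical

universe u

namespace Literature.NumberTheory.EllipticCurves

open Field
open Literature.NumberTheory.GaloisRepresentations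
open Literature.NumberTheory.GaloisRepresentations.DiscreteGaloisModule (mu MuCarrier pairing)

variable {F : Type u} [Field F] {M : Type u} [AddCommGroup M] [TopologicalSpace M] [DiscreteTopology M]
  (ρM : DiscreteGaloisModule F M) (N : ℕ) [NeZero N]
  (e : M → M → AlgebraicClosure F)
  (hμ : ∀ S T, e S T ^ N = 1)
  (hadd₁ : ∀ S₁ S₂ T, e (S₁ + S₂) T = e S₁ T * e S₂ T)
  (hadd₂ : ∀ S T₁ T₂, e S (T₁ + T₂) = e S T₁ * e S T₂)

/-- The value `e S T ∈ μ_N(F̄)` as an element of `MuCarrier F N = Additive (rootsOfUnity N F̄)` (Mathlib `rootsOfUnity.mkOfPowEq`);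
generic-coefficient twin of `weilPairingValue`. [cite: MilneADT2006, Ch. I §0 (pairings of `G`-modules)] -/
def pairingValueOfFun (S T : M) : MuCarrier F N :=
  MuCarrier.ofRootsOfUnity (rootsOfUnity.mkOfPowEq (e S T) (hμ S T))

omit [AddCommGroup M] [TopologicalSpace M] [DiscreteTopology M] in
/-- The underlying element of `F̄` of `pairingValueOfFun` is `e S T`. [cite: MilneADT2006, Ch. I §0] -/
@[simp] theorem coe_pairingValueOfFun (S T : M) :
    (((MuCarrier.toAdditive (pairingValueOfFun N e hμ S T)).toMul : (AlgebraicClosure F)ˣ) : AlgebraicClosure F) = e S T := rfl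

/-- **A biadditive `μ_N`-valued pairing, additively**: `(S, T) ↦ e S T` as `M →+ M →+ μ_N` (the shape `B : M →+ N →+ P` of the tree's
`DiscreteGaloisModule.pairing`); twin of `weilPairingHom`. [cite: MilneADT2006, Ch. I §0 (pairings of `G`-modules)] -/
def pairingHomOfFun : M →+ M →+ MuCarrier F N :=
  AddMonoidHom.mk' (fun S ↦ AddMonoidHom.mk' (fun T ↦ pairingValueOfFun N e hμ S T)
      fun T₁ T₂ ↦ by
        rw [muCarrier_eq_iff]
        change e S (T₁ + T₂) = e S T₁ * e S T₂
        exact hadd₂ S T₁ T₂)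
    fun S₁ S₂ ↦ by
      ext T
      rw [AddMonoidHom.mk'_apply, AddMonoidHom.add_apply, AddMonoidHom.mk'_apply, AddMonoidHom.mk'_apply, muCarrier_eq_iff]
      change e (S₁ + S₂) T = e S₁ T * e S₂ T
      exact hadd₁ S₁ S₂ T

omit [TopologicalSpace M] [DiscreteTopology M] in
/-- Unfolding `pairingHomOfFun` on underlying elements of `F̄`. [cite: MilneADT2006, Ch. I §0] -/
@[simp] theorem coe_pairingHomOfFun (S T : M) :
    (((MuCarrier.toAdditive (pairingHomOfFun N e hμ hadd₁ hadd₂ S T)).toMul : (AlgebraicClosure F)ˣ) : AlgebraicClosure F) = e S T := rfl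

variable (hgal : ∀ (σ : absoluteGaloisGroup F) (S T : M), σ • e S T = e (ρM σ S) (ρM σ T))

/-- **The pairing `e` as a continuous `Γ_F`-equivariant pairing of `TopRep`s** `M × M → μ_N` (the tree's `DiscreteGaloisModule.pairing`; Galois
equivariance `σ(e(S,T)) = e(σS, σT)`); twin of `weilContPairing` — the input of `ContPairing.cupProduct` / `coindFin` / `localTatePairing`-type
constructions for the coefficient module `M`. [cite: MilneADT2006, Ch. I §0 and §2 Cor. 2.3] -/
def contPairingOfFun : ContPairing ρM.toTopRep ρM.toTopRep (mu F N).toTopRep :=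
  pairing ρM ρM (mu F N) (pairingHomOfFun N e hμ hadd₁ hadd₂) fun σ S T ↦ by
    rw [muCarrier_eq_iff, coe_pairingHomOfFun, DiscreteGaloisModule.mu_apply_apply, toMul_ofMul,
      absoluteGaloisGroup.coe_smul_rootsOfUnity, Units.coe_smul, coe_pairingHomOfFun]
    exact (hgal σ S T).symm

/-- Unfolding `contPairingOfFun`: its bilinear map is `pairingHomOfFun`. [cite: MilneADT2006, Ch. I §0] -/
@[simp] theorem contPairingOfFun_toLin_apply (S T : M) :
    (contPairingOfFun ρM N e hμ hadd₁ hadd₂ hgal).toLin S T = pairingHomOfFun N e hμ hadd₁ hadd₂ S T := rfl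

end Literature.NumberTheory.EllipticCurves

/-! ## Over a number field: the local pairings at a place -/

namespace Literature.NumberTheory.EllipticCurves

open NumberField Field
open Literature.NumberTheory.GaloisRepresentations
open Literature.NumberTheory.GaloisRepresentations.DiscreteGaloisModule (mu MuCarrier pairing)

variable {K : Type u} [Field K] [NumberField K] {M : Type u} [AddCommGroup M] [TopologicalSpace M] [DiscreteTopology M]
  (ρM : DiscreteGaloisModule K M) (N : ℕ) [NeZero N]
  (e : M → M → AlgebraicClosure K)
  (hμ : ∀ S T, e S T ^ N = 1)
  (hadd₁ : ∀ S₁ S₂ T, e (S₁ + S₂) T = e S₁ T * e S₂ T)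
  (hadd₂ : ∀ S T₁ T₂, e S (T₁ + T₂) = e S T₁ * e S T₂)
  (hgal : ∀ (σ : absoluteGaloisGroup K) (S T : M), σ • e S T = e (ρM σ S) (ρM σ T))

/-- **The pairing restricted to the decomposition group at a place `v`** (`toLocal v`): `M|_v × M|_v → μ_N|_v`; twin of `weilContPairingLocal`
(the Poitou–Tate / local Tate duality input). [cite: MilneADT2006, Ch. I §2 Cor. 2.3] -/
def contPairingOfFunLocal (v : Place K) :
    ContPairing (ρM.toLocal v).toTopRep (ρM.toLocal v).toTopRep ((mu K N).toLocal v).toTopRep :=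
  pairing (ρM.toLocal v) (ρM.toLocal v) ((mu K N).toLocal v) (pairingHomOfFun N e hμ hadd₁ hadd₂) fun σ S T ↦
    (contPairingOfFun ρM N e hμ hadd₁ hadd₂ hgal).toLin_smul (absGaloisRestrict K (Place.Completion v) σ) S T

/-- Unfolding `contPairingOfFunLocal`: its bilinear map is `pairingHomOfFun`. [cite: MilneADT2006, Ch. I §2 Cor. 2.3] -/
@[simp] theorem contPairingOfFunLocal_toLin_apply (v : Place K) (S T : M) :
    (contPairingOfFunLocal ρM N e hμ hadd₁ hadd₂ hgal v).toLin S T = pairingHomOfFun N e hμ hadd₁ hadd₂ S T := rfl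

end Literature.NumberTheory.EllipticCurves

end
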